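import Summits.QuantumFields.BalabanUV.T4Continuum.Spine.NE5.TwoRunTorusRate
import Summits.QuantumFields.BalabanUV.T4Continuum.Spine.NE5.TwoRunTorusNE5

/-!
# Spine/NE5/TwoRunTorusNE5Pencil — `T4OutputRate.NE5` BY NAME from per-scale HOLOMORPHIC OUTPUT PENCILS
# (cell `pub-balaban-gaps`, seat `ne5` gen 9)

WHY.  T16 `TwoRunTorusNE5.ne5_of_torus_rates_all_scales` reads per-scale two-run RATES (an inequality at each scale with
`θ^j < s`) plus the one-run envelopes as the typed estimate `T4OutputRate.NE5` BY NAME.  What the walk-record chain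
actually DELIVERS per scale (T26 `TwoRunTorusWalkOutput.differentiableOn_E_torus_of_termWalkData` ∕ T29
`TwoRunTorusWalkOutputLetters.differentiableOn_E_torus_of_records_symm` with `B = ℂ`) is one level earlier: the OUTPUT
PENCIL `b ↦ E_j^b(X)(φ)` holomorphic on the window `ball 0 (s∕θ^j)` with the (2.41) envelope uniform along it.  THIS FILE
is the top of the chain in that currency: `ne5_of_output_pencils` — per scale the two runs are the members `0` and `1` of
a pencil; where `θ^j < s` the pencil is holomorphic on `ball 0 (s∕θ^j)` with `‖E_j^b(X)(φ)‖ ≤ A e^{−κ′d(X)}` along it; at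
every scale the two members obey that envelope (each run's own (2.41)); then `T4OutputRate.NE5` holds for the two runs'
real functionals with rate `θ` and constant `2A∕s` — T14's Schwarz step `norm_sub_le_of_pencil` feeding T16.  So on
the periodic carrier: (per scale, per term: walk records + non-walk data + numerics) ⟹ (T29∕T26) output pencils ⟹ (this
file) `T4OutputRate.NE5` BY NAME.

HONEST FRAMING.  Plumbing over LANDED shapes (T14 §1, T16); every family and number is a HYPOTHESIS; nothing of Bałaban's
asserted; the EXISTENCE of such pencils for Bałaban's runs with window `s∕θ^j` (the two-run rate `θ` of rows NE2∕NE3) is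
NODE O's ∕ NE2–NE3's, not claimed; NE5 NOT PRINTED ∕ NOT PROVED; leaves 0∕12; (D4) 0∕1; spine 0∕9.  Rung (B)+1 on a FIXED
finite T⁴ — NOT continuum, NOT infinite volume, NOT mass gap, NOT Clay.  0 sorry, 0 `def`.

Sources: [I] = T. Bałaban, CMP **109** (1987) [Balaban1987RG1] (1.18) p. 263; [II] = CMP **116** (1988)
[Balaban1988RG2Cluster] (2.41) p. 21; C. King, CMP **102** (1986) [King1986] Thm 3.4 (3.9) p. 656, p. 665.
-/

noncomputable section

namespace Summit.QuantumFields.BalabanUV.T4Continuum.Spine.NE5.TwoRunTorusNE5Pencil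

open Metric Set
open Literature.MathematicalPhysics.QuantumFieldTheory.Balaban1983to89
open Literature.MathematicalPhysics.QuantumFieldTheory.Balaban1983to89.T4OutputRate (NE5)
open Literature.MathematicalPhysics.QuantumFieldTheory.Balaban1983to89.TreeLengthTorus (TDom tsys)
open Literature.MathematicalPhysics.QuantumFieldTheory.Balaban1983to89.B13Lemma3Torus (TwoTorusStep)
open Summit.QuantumFields.BalabanUV.T4Continuum.Spine.NE5.TwoRunTorusRate (norm_sub_le_of_pencil)
open Summit.QuantumFields.BalabanUV.T4Continuum.Spine.NE5.TwoRunTorusNE5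
  (torusCarriers reFunctional ne5_of_torus_rates_all_scales)

variable {L : ℕ} [NeZero L]

/-- **`T4OutputRate.NE5` BY NAME FROM PER-SCALE HOLOMORPHIC OUTPUT PENCILS.**  Data: a torus model `W j` per creation
scale `j`, one OUTPUT PENCIL `E j : ℂ → 𝐃_{k+1} → Φ_j → ℂ` per scale (run A = member `0`, run B = member `1`), a rate
`0 < θ`, a margin `0 < s`, an envelope constant `A ≥ 0` and rate `κ′`.  Hypotheses: (i) at every scale both members
obey the one-run (2.41) envelope `‖E_j^{0,1}(X)(φ)‖ ≤ A e^{−κ′d(X)}` on the space; (ii) at every scale with `θ^j < s` the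
pencil is holomorphic on the window `ball 0 (s∕θ^j)` with the same envelope along it (the conclusion of T26 ∕ T29 with
`B = ℂ`, `α = s∕θ^j`).  Conclusion: `NE5 (reFunctional E·⁰) (reFunctional E·¹) W′ κ′ θ (2A∕s)` for every coupling window —
T14's Schwarz step + T16. [cite: Balaban1987RG1, (1.18) p.263; Balaban1988RG2Cluster, (2.41) p.21; King1986, Thm 3.4 p.656, p.665] -/
theorem ne5_of_output_pencils (N : ℕ → ℕ) [∀ j, NeZero (N j)] (W : (j : ℕ) → TwoTorusStep 4 L (N j))
    (E : (j : ℕ) → ℂ → TDom 4 (N j) → (W j).Φ → ℂ) {A κ' θ s : ℝ} (hA : 0 ≤ A) (hθ : 0 < θ) (hs : 0 < s)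
    (henv : ∀ (j : ℕ) (X : TDom 4 (N j)) (φ : (W j).Φ), φ ∈ (W j).sp2 X →
      ‖E j 0 X φ‖ ≤ A * Real.exp (-(κ' * (tsys 4 (N j)).dj X)) ∧
        ‖E j 1 X φ‖ ≤ A * Real.exp (-(κ' * (tsys 4 (N j)).dj X)))
    (hpencil : ∀ (j : ℕ), θ ^ j < s → ∀ (X : TDom 4 (N j)) (φ : (W j).Φ), φ ∈ (W j).sp2 X →
      DifferentiableOn ℂ (fun b => E j b X φ) (ball (0 : ℂ) (s / θ ^ j)) ∧
        ∀ b ∈ ball (0 : ℂ) (s / θ ^ j), ‖E j b X φ‖ ≤ A * Real.exp (-(κ' * (tsys 4 (N j)).dj X)))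
    (W' : Set (ℕ → ℝ)) :
    NE5 (C := torusCarriers N W) (reFunctional N W fun j => E j 0) (reFunctional N W fun j => E j 1) W' κ' θ
      (2 * A / s) := by
  refine ne5_of_torus_rates_all_scales N W (fun j => E j 0) (fun j => E j 1) hA hθ hs
    (fun j X φ hφ => (henv j X φ hφ).1) (fun j X φ hφ => (henv j X φ hφ).2) (fun j hj X φ hφ => ?_) W'
  -- the Schwarz step on the window `ball 0 (s/θ^j)`, radius `> 1`
  have hρ : 1 < s / θ ^ j := (one_lt_div (pow_pos hθ j)).2 hj
  obtain ⟨hhol, hbd⟩ := hpencil j hj X φ hφ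
  exact norm_sub_le_of_pencil hρ hhol hbd

end Summit.QuantumFields.BalabanUV.T4Continuum.Spine.NE5.TwoRunTorusNE5Pencil

end
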